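import Mathlib
import Summits.ValiantsHypothesis.ValiantsHypothesis.Theses.GrenetZeon
import Literature.Barriers.ValiantsHypothesis.PartialDerivativesDetPerm
import HarnessLib

/-!
# Route GrenetZeon — the diagonal corner is exact (item stmt-ValiantsHypothesis-8068)

`DiagonalBound`: if `per_n = λ(∏_{i=1}^n L_i)` coefficientwise, for affine forms `L_i` with
coefficients in a finite-dimensional commutative `ℂ`-algebra `R` and a `ℂ`-linear functional
`λ : R → ℂ`, then `dim_ℂ R ≥ C(n, ⌊n/2⌋)`.

Proof (the method of partial derivatives, Nisan–Wigderson / Landsberg Ex. 6.2.2.7, run against a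
commutative coefficient algebra): write `Λ` for `λ` applied coefficientwise
(`AddMonoidAlgebra.map`), a `ℂ`-linear map `R[x] → ℂ[x]` commuting with every `∂/∂x_v`
(`coeff_pderiv`). An order-`k` iterated partial derivative of `∏ L_i` lies in the `R`-span of the
`(n-k)`-fold sub-products `∏_{j ∈ T} L_j`, `|T| = n - k` (Leibniz; `∂_v L_i ∈ R` because `L_i` is
affine). Hence every order-`k` partial of `per_n = Λ(∏ L_i)` lies in the range of the `ℂ`-linear
map `Ψ : R^{T} → ℂ[x]`, `r ↦ Σ_T Λ(r_T · ∏_{j∈T} L_j)`, of rank `≤ C(n,k) · dim R`; the tree's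
`flatteningRank_perPoly` (`Literature/Barriers/ValiantsHypothesis/PartialDerivativesDetPerm.lean`:
the order-`k` partials of `per_n` span `C(n,k)²` dimensions) gives `C(n,k)² ≤ C(n,k) · dim R`.

* `diagonalBound_proof : DiagonalBound` — the item, verbatim.

Honest framing: route bookkeeping for `GrenetZeon` (the corner `m = n` of the two-parameter
model: Glynn's `2^{n-1}` is optimal up to `2√n`); no statement about VP ≠ VNP is proved and
nothing here is progress on it.

## References

* N. Nisan, A. Wigderson, *Lower bounds on arithmetic circuits via partial derivatives*,
  Comput. Complexity 6 (1996) 217–234 (the partial-derivative dimension measure).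
  [cite: NisanWigderson1996, §2]
* J. M. Landsberg, *Geometry and Complexity Theory*, CUP 2017, Exercise 6.2.2.7 and §10.4.4
  (`dim ∂^{=k} per_n = C(n,k)²`; in tree as `flatteningRank_perPoly`).
  [cite: LandsbergGCT2017, Exercise 6.2.2.7]
-/

set_option linter.dupNamespace false

noncomputable section

open MvPolynomial Finset

namespace Summit.ValiantsHypothesis.ValiantsHypothesis.Theorems.GrenetZeonDiagonal

open Literature.Barriers.ValiantsHypothesis Literature.Computability.AlgebraicComplexity

/-! ### §1 `λ` applied coefficientwise -/

section Coefficientwise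

variable {σ : Type*} {R : Type*} [CommRing R] [Algebra ℂ R] (l : R →ₗ[ℂ] ℂ)

/-- Coefficients of `λ` applied coefficientwise. [folklore] -/
theorem coeff_mapL (p : MvPolynomial σ R) (m : σ →₀ ℕ) :
    coeff m (AddMonoidAlgebra.map l.toAddMonoidHom p : MvPolynomial σ ℂ) = l (coeff m p) := rfl

/-- `Λ` is additive. [folklore] -/
theorem mapL_add (p q : MvPolynomial σ R) :
    (AddMonoidAlgebra.map l.toAddMonoidHom (p + q) : MvPolynomial σ ℂ) =
      AddMonoidAlgebra.map l.toAddMonoidHom p + AddMonoidAlgebra.map l.toAddMonoidHom q := by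
  ext m
  simp only [coeff_mapL, coeff_add, map_add]

/-- `Λ` is `ℂ`-homogeneous. [folklore] -/
theorem mapL_smul (c : ℂ) (p : MvPolynomial σ R) :
    (AddMonoidAlgebra.map l.toAddMonoidHom (c • p) : MvPolynomial σ ℂ) =
      c • AddMonoidAlgebra.map l.toAddMonoidHom p := by
  ext m
  simp only [coeff_mapL, coeff_smul, map_smul]

/-- `Λ 0 = 0`. [folklore] -/
theorem mapL_zero :
    (AddMonoidAlgebra.map l.toAddMonoidHom (0 : MvPolynomial σ R) : MvPolynomial σ ℂ) = 0 := by
  ext m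
  simp only [coeff_mapL, coeff_zero, map_zero]

/-- `Λ` commutes with the partial derivatives: `Λ(∂_v p) = ∂_v Λ(p)` (`λ` is `ℂ`-linear, and
`∂_v` rescales coefficients by natural numbers). [folklore] -/
theorem mapL_pderiv (v : σ) (p : MvPolynomial σ R) :
    (AddMonoidAlgebra.map l.toAddMonoidHom (pderiv v p) : MvPolynomial σ ℂ) =
      pderiv v (AddMonoidAlgebra.map l.toAddMonoidHom p) := by
  ext m
  rw [coeff_mapL, coeff_pderiv, coeff_pderiv, coeff_mapL]
  have h : coeff (m + Finsupp.single v 1) p * ((m v : R) + 1) =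
      ((m v + 1 : ℕ) : ℂ) • coeff (m + Finsupp.single v 1) p := by
    rw [Nat.cast_smul_eq_nsmul, nsmul_eq_mul, mul_comm]
    push_cast
    ring
  rw [h, map_smul, smul_eq_mul, mul_comm]
  push_cast
  ring

/-- `Λ` commutes with iterated partial derivatives. [folklore] -/
theorem mapL_iterPDeriv (li : List σ) (p : MvPolynomial σ R) :
    (AddMonoidAlgebra.map l.toAddMonoidHom (iterPDeriv li p) : MvPolynomial σ ℂ) =
      iterPDeriv li (AddMonoidAlgebra.map l.toAddMonoidHom p) := by
  induction li with
  | nil => rfl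
  | cons v li ih => rw [iterPDeriv_cons, iterPDeriv_cons, mapL_pderiv, ih]

/-- The order-`k` derivatives of `Λ p` are the images of those of `p`. [folklore] -/
theorem derivSet_mapL (k : ℕ) (p : MvPolynomial σ R) :
    derivSet k (AddMonoidAlgebra.map l.toAddMonoidHom p : MvPolynomial σ ℂ) =
      (fun q => (AddMonoidAlgebra.map l.toAddMonoidHom q : MvPolynomial σ ℂ)) '' derivSet k p := by
  ext h
  simp only [derivSet, Set.mem_setOf_eq, Set.mem_image]
  constructor
  · rintro ⟨li, hli, rfl⟩
    exact ⟨iterPDeriv li p, ⟨li, hli, rfl⟩, mapL_iterPDeriv l li p⟩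
  · rintro ⟨q, ⟨li, hli, rfl⟩, rfl⟩
    exact ⟨li, hli, mapL_iterPDeriv l li p⟩

end Coefficientwise

/-! ### §2 Derivatives of a product of affine forms -/

section AffineProduct

variable {σ : Type*} {R : Type*} [CommRing R]

/-- The partial derivative of an affine form is a constant: `∂_v L = C (coeff x_v L)`.
[folklore] -/
theorem pderiv_eq_C_of_totalDegree_le_one (v : σ) (L : MvPolynomial σ R)
    (hL : L.totalDegree ≤ 1) : pderiv v L = C (coeff (Finsupp.single v 1) L) := by
  classical
  ext m
  rw [coeff_pderiv, coeff_C]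
  by_cases hm : m = 0
  · subst hm
    simp
  · rw [if_neg (Ne.symm hm)]
    have hnot : m + Finsupp.single v 1 ∉ L.support := by
      intro hmem
      have hdeg : (m + Finsupp.single v 1).degree ≤ 1 := (le_totalDegree hmem).trans hL
      rw [map_add, Finsupp.degree_single] at hdeg
      have : m.degree = 0 := by omega
      exact hm ((Finsupp.degree_eq_zero_iff m).1 this)
    rw [notMem_support_iff.1 hnot, zero_mul]

/-- **Leibniz for a product of affine forms**: `∂_v ∏_{j ∈ T} L_j = Σ_{i ∈ T} c_i · ∏_{j ∈ T \ i} L_j`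
with the constants `c_i = coeff x_v L_i`. [folklore] -/
theorem pderiv_prod_affine [DecidableEq σ] {ι : Type*} [DecidableEq ι] (v : σ)
    (L : ι → MvPolynomial σ R) (hL : ∀ i, (L i).totalDegree ≤ 1) (T : Finset ι) :
    pderiv v (∏ j ∈ T, L j) =
      ∑ i ∈ T, coeff (Finsupp.single v 1) (L i) • ∏ j ∈ T.erase i, L j := by
  induction T using Finset.induction_on with
  | empty => simp
  | insert a T ha ih =>
    rw [prod_insert ha, pderiv_mul, ih, sum_insert ha, erase_insert ha,
      pderiv_eq_C_of_totalDegree_le_one v (L a) (hL a), mul_sum]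
    congr 1
    · rw [smul_eq_C_mul]
    · refine sum_congr rfl fun i hi => ?_
      have hai : a ≠ i := fun h => ha (h ▸ hi)
      rw [erase_insert_of_ne hai, prod_insert (fun h => ha (mem_of_mem_erase h)),
        smul_eq_C_mul, smul_eq_C_mul]
      ring

/-- The `R`-span of the `c`-fold sub-products `∏_{j∈T} L_j`, `|T| = c`, is mapped by `∂_v` into
the span of the `(c-1)`-fold ones. [folklore] -/
theorem pderiv_mem_span_subprod [DecidableEq σ] {ι : Type*} [DecidableEq ι] (v : σ)
    (L : ι → MvPolynomial σ R) (hL : ∀ i, (L i).totalDegree ≤ 1) {c : ℕ} {p : MvPolynomial σ R}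
    (hp : p ∈ Submodule.span R {q | ∃ T : Finset ι, T.card = c + 1 ∧ q = ∏ j ∈ T, L j}) :
    pderiv v p ∈ Submodule.span R {q | ∃ T : Finset ι, T.card = c ∧ q = ∏ j ∈ T, L j} := by
  have key : (Submodule.span R {q | ∃ T : Finset ι, T.card = c + 1 ∧ q = ∏ j ∈ T, L j}).map
      ((pderiv v : Derivation R (MvPolynomial σ R) (MvPolynomial σ R)) :
        MvPolynomial σ R →ₗ[R] MvPolynomial σ R) ≤
      Submodule.span R {q | ∃ T : Finset ι, T.card = c ∧ q = ∏ j ∈ T, L j} := by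
    rw [Submodule.map_span_le]
    rintro q ⟨T, hT, rfl⟩
    change pderiv v (∏ j ∈ T, L j) ∈ _
    rw [pderiv_prod_affine v L hL T]
    refine Submodule.sum_mem _ fun i hi => Submodule.smul_mem _ _ (Submodule.subset_span ?_)
    exact ⟨T.erase i, by rw [card_erase_of_mem hi, hT]; rfl, rfl⟩
  exact key ⟨p, hp, rfl⟩

/-- An order-`k` iterated partial derivative of `∏_{i} L_i` (`|ι| = n` affine factors) lies in the
`R`-span of the `(n-k)`-fold sub-products. [folklore] -/
theorem iterPDeriv_prod_mem_span [DecidableEq σ] {ι : Type*} [Fintype ι] [DecidableEq ι]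
    (L : ι → MvPolynomial σ R) (hL : ∀ i, (L i).totalDegree ≤ 1) (li : List σ)
    (hk : li.length ≤ Fintype.card ι) :
    iterPDeriv li (∏ i, L i) ∈
      Submodule.span R {q | ∃ T : Finset ι, T.card = Fintype.card ι - li.length ∧
        q = ∏ j ∈ T, L j} := by
  induction li with
  | nil =>
    refine Submodule.subset_span ⟨univ, by simp, ?_⟩
    simp [iterPDeriv]
  | cons v li ih =>
    rw [iterPDeriv_cons]
    have hlen : (v :: li).length = li.length + 1 := rfl
    rw [hlen] at hk ⊢
    have ih' := ih (by omega)
    have hc : Fintype.card ι - li.length = (Fintype.card ι - (li.length + 1)) + 1 := by omega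
    rw [hc] at ih'
    exact pderiv_mem_span_subprod v L hL ih'

end AffineProduct

/-! ### §3 The dimension count -/

section Count

variable {σ : Type*} {R : Type*} [CommRing R] [Algebra ℂ R] (l : R →ₗ[ℂ] ℂ)

/-- `Λ` of the `R`-span of a finite family of polynomials `g_T` lies in the range of the
`ℂ`-linear map `r ↦ Σ_T Λ(r_T · g_T)` on `R^{T}`. [folklore] -/
theorem mapL_mem_range_of_mem_span {ι : Type*} [Fintype ι] [DecidableEq ι]
    (g : ι → MvPolynomial σ R) {p : MvPolynomial σ R}
    (hp : p ∈ Submodule.span R (Set.range g)) :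
    ∃ r : ι → R, (AddMonoidAlgebra.map l.toAddMonoidHom p : MvPolynomial σ ℂ) =
      ∑ T, AddMonoidAlgebra.map l.toAddMonoidHom (r T • g T) := by
  suffices h : ∀ s : R, ∃ r : ι → R,
      (AddMonoidAlgebra.map l.toAddMonoidHom (s • p) : MvPolynomial σ ℂ) =
        ∑ T, AddMonoidAlgebra.map l.toAddMonoidHom (r T • g T) by
    simpa using h 1
  induction hp using Submodule.span_induction with
  | mem q hq =>
    obtain ⟨T, rfl⟩ := hq
    intro s
    refine ⟨Pi.single T s, ?_⟩
    rw [Fintype.sum_eq_single T (fun T' hT' => by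
      rw [Pi.single_eq_of_ne hT', zero_smul, mapL_zero])]
    rw [Pi.single_eq_same]
  | zero =>
    intro s
    refine ⟨0, ?_⟩
    simp only [smul_zero, Pi.zero_apply, zero_smul, mapL_zero, sum_const_zero]
  | add q₁ q₂ _ _ ih₁ ih₂ =>
    intro s
    obtain ⟨r₁, h₁⟩ := ih₁ s
    obtain ⟨r₂, h₂⟩ := ih₂ s
    refine ⟨r₁ + r₂, ?_⟩
    rw [smul_add, mapL_add, h₁, h₂, ← sum_add_distrib]
    refine sum_congr rfl fun T _ => ?_
    rw [Pi.add_apply, add_smul, mapL_add]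
  | smul t q _ ih =>
    intro s
    obtain ⟨r, h⟩ := ih (s * t)
    exact ⟨r, by rw [smul_smul, h]⟩

end Count

/-! ### §4 The item -/

/-- **Route GrenetZeon, item `DiagonalBound` (stmt-ValiantsHypothesis-8068)**: if
`per_n = λ(∏_{i=1}^n L_i)` coefficientwise for affine forms `L_i` over a finite-dimensional
commutative `ℂ`-algebra `R`, then `C(n, ⌊n/2⌋) ≤ dim_ℂ R`. Partial-derivative dimension count
(module docstring) on top of the tree's `flatteningRank_perPoly`.
[cite: NisanWigderson1996, §2] [cite: LandsbergGCT2017, Exercise 6.2.2.7] -/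
theorem diagonalBound_proof : Theses.GrenetZeon.DiagonalBound := by
  classical
  intro n R _ _ _ l L hL hcoeff
  set k := n / 2 with hk
  have hkn : k ≤ n := Nat.div_le_self n 2
  -- `Λ (∏ L i) = per_n`
  set F : MvPolynomial (Fin n × Fin n) R := ∏ i, L i with hF
  have hΛF : (AddMonoidAlgebra.map l.toAddMonoidHom F : MvPolynomial (Fin n × Fin n) ℂ) =
      perPoly (Fin n) ℂ := by
    ext d
    rw [coeff_mapL]
    exact hcoeff d
  -- the index set of `(n-k)`-subsets and the map `Ψ`
  let g : {T : Finset (Fin n) // T.card = n - k} → MvPolynomial (Fin n × Fin n) R :=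
    fun T => ∏ j ∈ (T : Finset (Fin n)), L j
  have hcardι : Fintype.card {T : Finset (Fin n) // T.card = n - k} = n.choose k := by
    rw [Fintype.card_subtype]
    have : (univ.filter fun T : Finset (Fin n) => T.card = n - k) =
        (univ : Finset (Fin n)).powersetCard (n - k) := by
      ext T
      simp [mem_powersetCard]
    rw [this, card_powersetCard, card_univ, Fintype.card_fin, Nat.choose_symm hkn]
  let Ψ : ({T : Finset (Fin n) // T.card = n - k} → R) →ₗ[ℂ] MvPolynomial (Fin n × Fin n) ℂ :=
    { toFun := fun r => ∑ T, AddMonoidAlgebra.map l.toAddMonoidHom (r T • g T)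
      map_add' := fun r₁ r₂ => by
        rw [← sum_add_distrib]
        refine sum_congr rfl fun T _ => ?_
        rw [Pi.add_apply, add_smul, mapL_add]
      map_smul' := fun c r => by
        rw [RingHom.id_apply, smul_sum]
        refine sum_congr rfl fun T _ => ?_
        rw [Pi.smul_apply, smul_assoc, mapL_smul] }
  -- every order-`k` partial of `per_n` lies in `range Ψ`
  have hsub : Submodule.span ℂ (derivSet k (perPoly (Fin n) ℂ)) ≤ LinearMap.range Ψ := by
    rw [Submodule.span_le, ← hΛF, derivSet_mapL]
    rintro _ ⟨q, ⟨li, hli, rfl⟩, rfl⟩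
    have hmem := iterPDeriv_prod_mem_span L hL li (by rw [Fintype.card_fin]; omega)
    rw [Fintype.card_fin, hli] at hmem
    have hmem' : iterPDeriv li F ∈ Submodule.span R (Set.range g) := by
      refine Submodule.span_mono ?_ hmem
      rintro q ⟨T, hT, rfl⟩
      exact ⟨⟨T, hT⟩, rfl⟩
    obtain ⟨r, hr⟩ := mapL_mem_range_of_mem_span l g hmem'
    exact ⟨r, hr.symm⟩
  -- dimension count
  have hrank : (n.choose k) ^ 2 ≤ n.choose k * Module.finrank ℂ R := by
    have h1 : Module.finrank ℂ (Submodule.span ℂ (derivSet k (perPoly (Fin n) ℂ))) =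
        (n.choose k) ^ 2 := by
      rw [← shiftedPartialsRank_zero_eq, flatteningRank_perPoly]
    have h2 : Module.finrank ℂ (LinearMap.range Ψ) ≤ n.choose k * Module.finrank ℂ R := by
      refine (LinearMap.finrank_range_le Ψ).trans ?_
      rw [Module.finrank_pi_fintype, sum_const, card_univ, hcardι, smul_eq_mul]
    rw [← h1]
    exact (Submodule.finrank_mono hsub).trans h2
  have hpos : 0 < n.choose k := Nat.choose_pos hkn
  rw [sq] at hrank
  exact Nat.le_of_mul_le_mul_left hrank hpos

end Summit.ValiantsHypothesis.ValiantsHypothesis.Theorems.GrenetZeonDiagonal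

end
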